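import Mathlib
import HarnessLib
import Summits.HubbardSuperconductivity.HubbardSuperconductivity.Theorems.KLProgrammeKLRegimeEngineV8DefsG11
import Summits.HubbardSuperconductivity.HubbardSuperconductivity.Theorems.KLProgrammeKLRegimeSplitGeoShellLogPP

/-!
# K3 ENGINE package, `G`-level v12 — the post-FREEZE candidate «AMENDMENT 24 — (c)-OUT-G12» (plan g23 (R237), 2026-08-28 17:12Z/17:13Z):
# `klEngGeo12 := (klEngGeo11.addShellLogPP (2^52)).raiseCF klEngGeo11.CF` (cell gate-hubbard-kl, seat hubbard-kl-k3c2-p2 g19; memo OUT-OF-CLASS-E2.md §8–§9a)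

WHY.  The out-of-class half of (E2″-F)ₙ₊₁ is (i) a same-shell flow step (`outClass_sameFrame_le_bars`, booked into ONE step's bars at `klEngGeo11`) PLUS
(iii) the Wick re-ordering of the scale-`n` action by the shell covariance — a SECOND, cross-scale step («(c)-OUT-UNSMEAR», booked by the pen as a second copy of
the residue table) whose particle–particle bubble at the frozen total momentum `|p_Qm| = ρ > 32Λₙ₊₁` carries the shell count `kₙ(ρ)` («(c)-OUT-XLOG-PP»: the ph
gains have it since `klEngGeo9 = klEngGeo8.addShellLog (2^52)`, the pp gain did not).  The G-only cure, TEXT-NEUTRAL here (no package of record moves; the token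
swap `klEngGeo11 ↦ klEngGeo12` is AMENDMENT 24, gated per (R237)(b)):
* **`klEngGeo12 := (klEngGeo11.addShellLogPP (2^52)).raiseCF klEngGeo11.CF`** — the pp gain amended by `2⁵²·(klRelGain n (ρ⊔0) + 2⁻ⁿ)` (…SplitGeoShellLogPP) and the
  freezing constant DOUBLED (+ `7·2⁵²`), so that the second step's thermal share is a full second `thermalBar klEngGeo11`;
* `klEngGeo12_wf`; rfl / order rows: `phGain` unchanged, `ppGain` grows, `CF = 2·CF₁₁ + 7·2⁵²`, `cE4`/`S`/`SL`/`Bf`/`cloc`/`θ`/blocks/drive unchanged (so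
  `klE4TF/klE4T6/klE4T ≤ cE4`, `klS6 ≤ S` ride);
* THE BOOKING LINES of AMENDMENT 24: `gainBar_klEngGeo12_eq` (`gainBar G12 = gainBar G11 + (Klam U)²·2⁵²·(klRelGain n (ρpp⊔0) + 2⁻ⁿ)` — the second step's pp
  cross-scale slot), `shellCount_le_gainBar_klEngGeo12` (frozen branch `Λₙ ≤ ρpp`: `(Klam U)²·2⁵²·(Λₙ/ρpp)·(1 + kₙ(ρpp)) ≤ gainBar G12 − gainBar G11`),
  `two_mul_thermalBar_klEngGeo11_le_klEngGeo12` (`2·thermalBar G11 ≤ thermalBar G12` — the second step's thermal share), `thermalBar_klEngGeo11_le_klEngGeo12`,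
  `gainBar_klEngGeo11_le_klEngGeo12`; (E5-F) lifts (`isoTupleL1AtV17F_klEngGeo12_of_klEngGeo11`).
Definitions with bodies + order lemmas; nothing about the model is asserted; nothing asserts (E2″-F), (c), K3 or superconductivity.  0 kit · 0 lit.
-/

noncomputable section

namespace Summit.HubbardSuperconductivity.HubbardSuperconductivity.Theorems.EngineV8

set_option linter.dupNamespace false -- summit = problem name (single-conjunct summit), D-0017

open Real Finset Literature.MathematicalPhysics.QuantumLattice Literature.Probability.LatticeModels
open Summit.HubbardSuperconductivity.HubbardSuperconductivity.Theorems.KLRegimeSplit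
open Summit.HubbardSuperconductivity.HubbardSuperconductivity.Theorems.KLProgrammeLegKernels
open Summit.HubbardSuperconductivity.HubbardSuperconductivity.Theorems.DispersionFlow

/-! ## §1 The token candidate `klEngGeo12` -/

/-- **`klEngGeo12` — the engine-flow package's absolute constants `G`, v12 (AMENDMENT 24 candidate)**: `klEngGeo11` with the particle–particle gain amended by
`2⁵²·(klRelGain n (ρ⊔0) + 2⁻ⁿ)` and then the freezing constant raised by `klEngGeo11.CF` (doubled); nothing else moved. -/
def klEngGeo12 : GeoConsts := (klEngGeo11.addShellLogPP (2 ^ 52)).raiseCF klEngGeo11.CF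

/-- `klEngGeo12 = (klEngGeo11.addShellLogPP (2^52)).raiseCF klEngGeo11.CF` (`rfl`). -/
theorem klEngGeo12_eq : klEngGeo12 = (klEngGeo11.addShellLogPP (2 ^ 52)).raiseCF klEngGeo11.CF := rfl

/-- **`klEngGeo12` is well formed.** -/
theorem klEngGeo12_wf : klEngGeo12.WF :=
  GeoConsts.raiseCF_wf (GeoConsts.addShellLogPP_wf klEngGeo11_wf (by norm_num)) klEngGeo11_CF_nonneg

/-- `klEngGeo12.CF = (klEngGeo11.CF + 7·2⁵²) + klEngGeo11.CF`. -/
theorem klEngGeo12_CF : klEngGeo12.CF = klEngGeo11.CF + 7 * 2 ^ 52 + klEngGeo11.CF := rfl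

/-- `2·klEngGeo11.CF ≤ klEngGeo12.CF`. -/
theorem two_mul_klEngGeo11_CF_le_klEngGeo12_CF : 2 * klEngGeo11.CF ≤ klEngGeo12.CF := by rw [klEngGeo12_CF]; norm_num; linarith

/-- `klEngGeo11.CF ≤ klEngGeo12.CF`. -/
theorem klEngGeo11_CF_le_klEngGeo12_CF : klEngGeo11.CF ≤ klEngGeo12.CF := by
  have := klEngGeo11_CF_nonneg; rw [klEngGeo12_CF]; norm_num; linarith

/-- `0 ≤ klEngGeo12.CF`. -/
theorem klEngGeo12_CF_nonneg : 0 ≤ klEngGeo12.CF := klEngGeo11_CF_nonneg.trans klEngGeo11_CF_le_klEngGeo12_CF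

/-- `klIsoT⁴ ≤ klEngGeo12.CF` (rides). -/
theorem klIsoT_pow_four_le_klEngGeo12_CF : klIsoT ^ 4 ≤ klEngGeo12.CF := klIsoT_pow_four_le_klEngGeo11_CF.trans klEngGeo11_CF_le_klEngGeo12_CF

/-- the ph gain is UNCHANGED: `klEngGeo12.phGain = klEngGeo11.phGain`. -/
theorem klEngGeo12_phGain : klEngGeo12.phGain = klEngGeo11.phGain := rfl

/-- the amended pp gain: `klEngGeo12.ppGain n ρ = klEngGeo11.ppGain n ρ + 2⁵²·(klRelGain n (ρ⊔0) + 2⁻ⁿ)`. -/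
theorem klEngGeo12_ppGain (n : ℕ) (ρ : ℝ) : klEngGeo12.ppGain n ρ = klEngGeo11.ppGain n ρ + 2 ^ 52 * (klRelGain n (max ρ 0) + ((2 : ℝ) ^ n)⁻¹) := rfl

/-- `0 ≤ klEngGeo11.ppGain n ρ`. -/
theorem klEngGeo11_ppGain_nonneg (n : ℕ) (ρ : ℝ) : 0 ≤ klEngGeo11.ppGain n ρ := klEngGeo11_wf.2.2.2.2.2.2.2.2.2.2.2.1 n ρ

/-- `0 ≤ klEngGeo11.phGain n ρ`. -/
theorem klEngGeo11_phGain_nonneg (n : ℕ) (ρ : ℝ) : 0 ≤ klEngGeo11.phGain n ρ := klEngGeo11_wf.2.2.2.2.2.2.2.2.2.2.2.2.1 n ρ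

/-- the pp gain grows: `klEngGeo11.ppGain n ρ ≤ klEngGeo12.ppGain n ρ`. -/
theorem klEngGeo11_ppGain_le_klEngGeo12_ppGain (n : ℕ) (ρ : ℝ) : klEngGeo11.ppGain n ρ ≤ klEngGeo12.ppGain n ρ :=
  GeoConsts.ppGain_le_addShellLogPP (G := klEngGeo11) (C := 2 ^ 52) (by norm_num) n ρ

/-- **BOOKING LINE (pp addend)**: `2⁵²·(klRelGain n ρ + 2⁻ⁿ) ≤ klEngGeo12.ppGain n ρ` (`0 ≤ ρ`). -/
theorem shellLog_le_klEngGeo12_ppGain (n : ℕ) {ρ : ℝ} (hρ : 0 ≤ ρ) : 2 ^ 52 * (klRelGain n ρ + ((2 : ℝ) ^ n)⁻¹) ≤ klEngGeo12.ppGain n ρ :=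
  GeoConsts.klRelGain_le_addShellLogPP (G := klEngGeo11) (C := 2 ^ 52) (klEngGeo11_ppGain_nonneg n ρ) hρ

/-- untouched field `cE4`. -/
theorem klEngGeo12_cE4 : klEngGeo12.cE4 = klEngGeo11.cE4 := rfl
/-- `klE4TF ≤ klEngGeo12.cE4` (rides). -/
theorem klE4TF_le_klEngGeo12_cE4 : klE4TF ≤ klEngGeo12.cE4 := klE4TF_le_klEngGeo11_cE4
/-- `klE4T6 ≤ klEngGeo12.cE4` (rides). -/
theorem klE4T6_le_klEngGeo12_cE4 : klE4T6 ≤ klEngGeo12.cE4 := klE4T6_le_klEngGeo11_cE4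
/-- `klE4T ≤ klEngGeo12.cE4` (rides). -/
theorem klE4T_le_klEngGeo12_cE4 : klE4T ≤ klEngGeo12.cE4 := klE4T_le_klEngGeo11_cE4
/-- untouched field `S`. -/
theorem klEngGeo12_S : klEngGeo12.S = klEngGeo11.S := rfl
/-- `klS6 j ≤ klEngGeo12.S j` (rides). -/
theorem klS6_le_klEngGeo12_S (j : ℕ) : klS6 j ≤ klEngGeo12.S j := klS6_le_klEngGeo11_S j
/-- untouched field `SL`. -/
theorem klEngGeo12_SL : klEngGeo12.SL = klEngGeo11.SL := rfl
/-- untouched field `Bf`. -/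
theorem klEngGeo12_Bf : klEngGeo12.Bf = klEngGeo11.Bf := rfl
/-- untouched field `bhi`. -/
theorem klEngGeo12_bhi : klEngGeo12.bhi = klEngGeo11.bhi := rfl
/-- untouched field `blo`. -/
theorem klEngGeo12_blo : klEngGeo12.blo = klEngGeo11.blo := rfl
/-- untouched field `aplus`. -/
theorem klEngGeo12_aplus : klEngGeo12.aplus = klEngGeo11.aplus := rfl
/-- untouched field `ζ`. -/
theorem klEngGeo12_ζ : klEngGeo12.ζ = klEngGeo11.ζ := rfl
/-- untouched field `Z`. -/
theorem klEngGeo12_Z : klEngGeo12.Z = klEngGeo11.Z := rfl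
/-- untouched field `cloc`. -/
theorem klEngGeo12_cloc : klEngGeo12.cloc = klEngGeo11.cloc := rfl
/-- untouched field `θ`. -/
theorem klEngGeo12_θ : klEngGeo12.θ = klEngGeo11.θ := rfl
/-- untouched field `a`. -/
theorem klEngGeo12_a : klEngGeo12.a = klEngGeo11.a := rfl
/-- untouched field `atop`. -/
theorem klEngGeo12_atop : klEngGeo12.atop = klEngGeo11.atop := rfl
/-- untouched field `abot`. -/
theorem klEngGeo12_abot : klEngGeo12.abot = klEngGeo11.abot := rfl

/-! ## §2 The slots of (E2″-F) along `klEngGeo11 ↦ klEngGeo12` — the booking lines of AMENDMENT 24 -/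

/-- `eremBar` does not read the gains or `CF`: `eremBar klEngGeo12 = eremBar klEngGeo11`. -/
theorem eremBar_klEngGeo12_eq (P : SplitConsts) (Q : EngConsts) (U β : ℝ) (L n : ℕ) :
    eremBar klEngGeo12 P Q U β L n = eremBar klEngGeo11 P Q U β L n := rfl

/-- **`gainBar` along the amendment, EXACTLY**: `gainBar klEngGeo12 P U n ρpp ρd ρx = gainBar klEngGeo11 P U n ρpp ρd ρx + (Klam U)²·2⁵²·(klRelGain n (ρpp⊔0) + 2⁻ⁿ)`
— the second (cross-scale) step's particle–particle slot. -/
theorem gainBar_klEngGeo12_eq (P : SplitConsts) (U : ℝ) (n : ℕ) (ρpp ρd ρx : ℝ) :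
    gainBar klEngGeo12 P U n ρpp ρd ρx = gainBar klEngGeo11 P U n ρpp ρd ρx + (P.Klam * U) ^ 2 * (2 ^ 52 * (klRelGain n (max ρpp 0) + ((2 : ℝ) ^ n)⁻¹)) := by
  unfold gainBar
  rw [klEngGeo12_ppGain, klEngGeo12_phGain]
  ring

/-- `gainBar klEngGeo11 ≤ gainBar klEngGeo12`. -/
theorem gainBar_klEngGeo11_le_klEngGeo12 (P : SplitConsts) (U : ℝ) (n : ℕ) (ρpp ρd ρx : ℝ) :
    gainBar klEngGeo11 P U n ρpp ρd ρx ≤ gainBar klEngGeo12 P U n ρpp ρd ρx := by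
  rw [gainBar_klEngGeo12_eq]
  have hK : 0 ≤ (P.Klam * U) ^ 2 := sq_nonneg _
  have hg := klRelGain_nonneg n (le_max_right ρpp 0)
  have : 0 ≤ 2 ^ 52 * (klRelGain n (max ρpp 0) + ((2 : ℝ) ^ n)⁻¹) := by positivity
  nlinarith

/-- **THE OUT-OF-CLASS pp BOOKING TARGET at the token**: at a frozen pp transfer `Λₙ ≤ ρpp`,
`(Klam U)²·2⁵²·((Λₙ/ρpp)·(1 + kₙ(ρpp))) ≤ gainBar klEngGeo12 P U n ρpp ρd ρx − gainBar klEngGeo11 P U n ρpp ρd ρx`. -/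
theorem shellCount_le_gainBar_klEngGeo12 (P : SplitConsts) (U : ℝ) {n : ℕ} {ρpp : ℝ} (hρ : klScale klE0 n ≤ ρpp) (ρd ρx : ℝ) :
    (P.Klam * U) ^ 2 * (2 ^ 52 * (klScale klE0 n / ρpp * (1 + (klShellCount n ρpp : ℝ)))) ≤
      gainBar klEngGeo12 P U n ρpp ρd ρx - gainBar klEngGeo11 P U n ρpp ρd ρx := by
  rw [gainBar_klEngGeo12_eq, add_sub_cancel_left]
  have hK : 0 ≤ (P.Klam * U) ^ 2 := sq_nonneg _
  have hΛ : 0 < klScale klE0 n := klth_klScale_pos n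
  have hρ0 : 0 < ρpp := hΛ.trans_le hρ
  have hmin : min (ρpp / klScale klE0 n) (klScale klE0 n / ρpp) = klScale klE0 n / ρpp := by
    refine min_eq_right ?_
    rw [div_le_div_iff₀ hρ0 hΛ]
    nlinarith
  have hrel : klRelGain n ρpp = klScale klE0 n / ρpp * (1 + (klShellCount n ρpp : ℝ)) := by
    unfold klRelGain; rw [hmin]
  rw [← hrel, max_eq_left hρ0.le]
  have h2 : 0 ≤ ((2 : ℝ) ^ n)⁻¹ := by positivity
  nlinarith

/-- `thermalBar` along the amendment: `thermalBar klEngGeo11 ≤ thermalBar klEngGeo12`. -/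
theorem thermalBar_klEngGeo11_le_klEngGeo12 (P : SplitConsts) (U β : ℝ) (n : ℕ) :
    thermalBar klEngGeo11 P U β n ≤ thermalBar klEngGeo12 P U β n := by
  unfold thermalBar
  have := klEngGeo11_CF_le_klEngGeo12_CF
  have : 0 ≤ (P.Klam * U) ^ 2 * ((4 : ℝ) ^ (nScales β - n))⁻¹ := by positivity
  nlinarith

/-- **THE SECOND STEP'S THERMAL SHARE**: `2·thermalBar klEngGeo11 P U β n ≤ thermalBar klEngGeo12 P U β n` (the freezing constant is doubled). -/
theorem two_mul_thermalBar_klEngGeo11_le_klEngGeo12 (P : SplitConsts) (U β : ℝ) (n : ℕ) :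
    2 * thermalBar klEngGeo11 P U β n ≤ thermalBar klEngGeo12 P U β n := by
  unfold thermalBar
  have := two_mul_klEngGeo11_CF_le_klEngGeo12_CF
  have : 0 ≤ (P.Klam * U) ^ 2 * ((4 : ℝ) ^ (nScales β - n))⁻¹ := by positivity
  nlinarith

/-- **TWO COPIES OF ONE STEP'S BARS FIT THE TOKEN'S BARS (pp-frozen form)**: if the same-shell step is `≤ gainBar G11 + E + thermalBar G11` and the cross-scale step is
`≤ (Klam U)²·2⁵²·(klRelGain n (ρpp⊔0) + 2⁻ⁿ) + E′ + thermalBar G11`, their sum is `≤ gainBar G12 + (E + E′) + thermalBar G12`. -/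
theorem two_steps_le_bars_klEngGeo12 (P : SplitConsts) (U β : ℝ) (n : ℕ) (ρpp ρd ρx : ℝ) {S₁ S₃ E E' : ℝ}
    (h₁ : S₁ ≤ gainBar klEngGeo11 P U n ρpp ρd ρx + E + thermalBar klEngGeo11 P U β n)
    (h₃ : S₃ ≤ (P.Klam * U) ^ 2 * (2 ^ 52 * (klRelGain n (max ρpp 0) + ((2 : ℝ) ^ n)⁻¹)) + E' + thermalBar klEngGeo11 P U β n) :
    S₁ + S₃ ≤ gainBar klEngGeo12 P U n ρpp ρd ρx + (E + E') + thermalBar klEngGeo12 P U β n := by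
  have hg := gainBar_klEngGeo12_eq P U n ρpp ρd ρx
  have ht := two_mul_thermalBar_klEngGeo11_le_klEngGeo12 P U β n
  linarith

section Model

variable {L M : ℕ} [NeZero L] [NeZero M] {P : SplitConsts} {β U μ : ℝ} {n : ℕ}

/-- (E5-F) lifts along `klEngGeo11 ↦ klEngGeo12`. -/
theorem isoTupleL1AtV17F_klEngGeo12_of_klEngGeo11 (h : IsoTupleL1AtV17F L M klEngGeo11 P β U μ n) : IsoTupleL1AtV17F L M klEngGeo12 P β U μ n := by
  intro B hB hvals m hm Ω hΩ x₁
  refine (h B hB hvals m hm Ω hΩ x₁).trans ?_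
  have := klEngGeo11_CF_le_klEngGeo12_CF
  have hK : 0 ≤ (P.Klam * U) ^ 2 := sq_nonneg _
  nlinarith

end Model

end Summit.HubbardSuperconductivity.HubbardSuperconductivity.Theorems.EngineV8

end
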